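import Mathlib
import Literature.NumberTheory.Automorphic.HilbertModularFormQExpansion
import Summits.Langlands.Langlands.Theorems.CapacityClassicalityHilbertIntegralOverconvergentIsCongruenceStubFourierCoeffLinear

/-!
# The cone class of functions on the tube domain is a `ℂ`-submodule (stub S2)

Stub S2 `stub_coneClass_linear` of line Sketch-ideate-r1-k1 (section S, relations between encoded
`q`-expansions → relations between functions) for the crux `HilbertIntegralOverconvergentIsCongruence`
(stmt-Langlands-8485).  The CONE CLASS consists of the functions `f : ℍ → ℂ` that are holomorphic on
`ℍ`, `𝓞 F`-periodic on `ℍ`, and whose Fourier coefficients `a_μ(f)` vanish at every dual-lattice index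
`μ` off the cone `qIndexSet F`.  We show the class is closed under `f + c • g`, that the Fourier
coefficients at the standard height are linear, `a_μ(f + c g) = a_μ(f) + c a_μ(g)` (for every `μ`),
and that `a_μ(0) = 0`: holomorphy is `DifferentiableOn.add` / `DifferentiableOn.const_smul`,
periodicity is pointwise, and the coefficient identities are the landed linearity
`stub_fourierCoeff_linear` at height `y = (1, …, 1)` (holomorphic functions are continuous on `ℍ`);
cone support of `f + c • g` then follows from that of `f` and `g`.
-/

set_option linter.dupNamespace false

noncomputable section

namespace Summit.Langlands.Langlands.Theorems.HilbertIntegralOverconvergentIsCongruence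

open MeasureTheory Complex NumberField
open Literature.NumberTheory.Automorphic Literature.NumberTheory.Automorphic.HilbertModular

/-- **Stub S2 — `stub_coneClass_linear`.** The class of holomorphic `𝓞 F`-periodic functions on `ℍ`
with CONE-SUPPORTED Fourier coefficients (`a_μ = 0` for `μ ∈ 𝔡⁻¹ ∖ qIndexSet`) is a `ℂ`-submodule:
closed under `f + c • g`, with `a_μ(f + c g) = a_μ(f) + c a_μ(g)` and `a_μ(0) = 0` (linearity of the
Fourier coefficients, `stub_fourierCoeff_linear`). [folklore] -/
theorem stub_coneClass_linear (F : Type) [Field F] [NumberField F] (f g : Point F → ℂ) (c : ℂ)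
    (hf : IsHolomorphicOn F f) (hg : IsHolomorphicOn F g)
    (hperf : ∀ (a : 𝓞 F) (z : Point F), z ∈ halfSpace F → f (fun σ ↦ z σ + ((σ (a : F) : ℝ) : ℂ)) = f z)
    (hperg : ∀ (a : 𝓞 F) (z : Point F), z ∈ halfSpace F → g (fun σ ↦ z σ + ((σ (a : F) : ℝ) : ℂ)) = g z)
    (hsf : ∀ μ : F, (∀ a : 𝓞 F, ∃ n : ℤ, Algebra.trace ℚ F (μ * a) = n) → μ ∉ qIndexSet F → fourierCoeff f μ = 0)
    (hsg : ∀ μ : F, (∀ a : 𝓞 F, ∃ n : ℤ, Algebra.trace ℚ F (μ * a) = n) → μ ∉ qIndexSet F → fourierCoeff g μ = 0) :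
    (IsHolomorphicOn F (f + c • g) ∧
      (∀ (a : 𝓞 F) (z : Point F), z ∈ halfSpace F → (f + c • g) (fun σ ↦ z σ + ((σ (a : F) : ℝ) : ℂ)) = (f + c • g) z) ∧
      ∀ μ : F, (∀ a : 𝓞 F, ∃ n : ℤ, Algebra.trace ℚ F (μ * a) = n) → μ ∉ qIndexSet F → fourierCoeff (f + c • g) μ = 0) ∧
    (∀ μ : F, (∀ a : 𝓞 F, ∃ n : ℤ, Algebra.trace ℚ F (μ * a) = n) →
      fourierCoeff (f + c • g) μ = fourierCoeff f μ + c * fourierCoeff g μ) ∧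
    ∀ μ : F, fourierCoeff (0 : Point F → ℂ) μ = 0 := by
  -- holomorphic functions are continuous on `ℍ`, so the landed linearity applies at height `1`
  have hfc : ContinuousOn f (halfSpace F) := DifferentiableOn.continuousOn hf
  have hgc : ContinuousOn g (halfSpace F) := DifferentiableOn.continuousOn hg
  have hcgc : ContinuousOn (c • g) (halfSpace F) := hgc.const_smul c
  have h1 : ∀ σ : F →+* ℝ, (0 : ℝ) < (fun _ : F →+* ℝ ↦ (1 : ℝ)) σ := fun _ ↦ one_pos
  -- linearity of the coefficients, for every index `μ`
  have hlin : ∀ μ : F, fourierCoeff (f + c • g) μ = fourierCoeff f μ + c * fourierCoeff g μ := by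
    intro μ
    have hadd := (stub_fourierCoeff_linear F f (c • g) hfc hcgc c μ (fun _ ↦ 1) h1).1
    have hsmul := (stub_fourierCoeff_linear F g f hgc hfc c μ (fun _ ↦ 1) h1).2.1
    simp only [fourierCoeff_eq, hadd, hsmul]
  refine ⟨⟨DifferentiableOn.add hf (DifferentiableOn.const_smul hg c), fun a z hz ↦ ?_,
    fun μ hμ hμc ↦ ?_⟩, fun μ _ ↦ hlin μ, fun μ ↦ ?_⟩
  · -- periodicity is pointwise
    simp only [Pi.add_apply, Pi.smul_apply, hperf a z hz, hperg a z hz]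
  · -- cone support from the identity and the cone support of `f`, `g`
    rw [hlin μ, hsf μ hμ hμc, hsg μ hμ hμc, mul_zero, add_zero]
  · -- the zero function has zero coefficients
    rw [fourierCoeff_eq]
    exact (stub_fourierCoeff_linear F f g hfc hgc c μ (fun _ ↦ 1) h1).2.2

end Summit.Langlands.Langlands.Theorems.HilbertIntegralOverconvergentIsCongruence
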